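import Literature.NumberTheory.Sieve.BombieriVinogradovMoebius
import HarnessLib

/-!
# Incomplete sums of a non-principal character along an arithmetic progression: the period bound

Topic `Literature/NumberTheory/Sieve`; theorems only, everything PROVED (elementary).  For a Dirichlet
character `χ mod s`, `χ ≠ χ₀`, with conductor `f`, and a progression `n ≡ t (mod L)` with `(L, s) = 1`,

`|∑_{A ≤ n ≤ B, n ≡ t (L)} χ(n)| ≤ τ(s) · f`  (`norm_sum_Icc_filter_char_le`),

uniformly in the interval.  Proof: `χ(n) = ψ(n) 1_{(n, s/f) = 1}` with `ψ` the primitive character inducing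
`χ` (`BVMoebius.changeLevel_apply_natCast`); Möbius inversion of the coprimality condition costs a factor
`τ(s/f) ≤ τ(s)`; for `e ∣ s/f` with `(e, f) = 1` the conditions `n ≡ t (L)`, `e ∣ n` cut out one class
`mod Le`, and `n ↦ ψ(n)` restricted to that class is `(Le·f)`-periodic with vanishing period sums (the `f`
members of the class in a period have distinct residues `mod f`, since `(Le, f) = 1`, and `∑_{v mod f} ψ(v) = 0`),
while fewer than `Le f` consecutive integers contain at most `f` members of the class.  This is the trivial
("complete the sum") substitute for Pólya–Vinogradov that suffices when `f` is small (characters of small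
conductor, e.g. the subtracted characters of Drappeau's kernel `𝔲_R`, PLMS 114 (2017) §5 (5.1)).

* `card_Ico_filter_natCast_eq_le`, `filter_Ico_natCast_eq_eq_image` — a residue class in a window;
* `norm_sum_Ico_le_of_periodic` — partial sums of a sequence with vanishing period sums;
* `sum_filter_natCast_eq_window_eq_zero`, `norm_sum_Ico_filter_natCast_eq_le` — the primitive case;
* `ite_coprime_eq_sum_divisors` — Möbius detection of coprimality (complex weights);
* `norm_sum_Icc_filter_char_le` — the bound above.

## References

* H. L. Montgomery, R. C. Vaughan, *Multiplicative Number Theory I*, CUP 2007, §4.3 (4.23) and §9.1.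
  [MontgomeryVaughan2007]
-/

open Finset
open scoped ArithmeticFunction.sigma ArithmeticFunction.Moebius

namespace Literature.NumberTheory.Sieve

namespace CharacterAP

/-! ### A residue class in a window of consecutive integers -/

/-- At most `r/m + 1` of `r` consecutive integers lie in a given class `mod m`. [folklore] -/
theorem card_Ico_filter_natCast_eq_le {m : ℕ} (c : ZMod m) (a r : ℕ) :
    ((Ico a (a + r)).filter (fun n : ℕ => (n : ZMod m) = c)).card ≤ r / m + 1 := by
  calc ((Ico a (a + r)).filter (fun n : ℕ => (n : ZMod m) = c)).card
      ≤ (Finset.range (r / m + 1)).card := by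
        refine Finset.card_le_card_of_injOn (fun n => (n - a) / m) (fun n hn => ?_) ?_
        · rw [Finset.mem_coe, Finset.mem_filter, Finset.mem_Ico] at hn
          rw [Finset.mem_coe, Finset.mem_range]
          exact Nat.lt_succ_of_le (Nat.div_le_div_right (by omega))
        · intro n₁ hn₁ n₂ hn₂ heq
          rw [Finset.mem_coe, Finset.mem_filter, Finset.mem_Ico] at hn₁ hn₂
          have h1 : (n₁ - a) % m = (n₂ - a) % m := by
            have e1 : ((n₁ - a : ℕ) : ZMod m) = ((n₂ - a : ℕ) : ZMod m) := by
              rw [Nat.cast_sub hn₁.1.1, Nat.cast_sub hn₂.1.1, hn₁.2, hn₂.2]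
            exact (ZMod.natCast_eq_natCast_iff _ _ _).1 e1
          have e₁ := Nat.div_add_mod (n₁ - a) m
          have e₂ := Nat.div_add_mod (n₂ - a) m
          simp only at heq
          rw [heq] at e₁
          omega
    _ = r / m + 1 := Finset.card_range _

/-- **A class in a window of `f` periods**: the members of the class `c mod m` among
`a, a+1, …, a + mf − 1` are `n₁, n₁ + m, …, n₁ + (f−1)m` for some `n₁ ≡ c`. [folklore] -/
theorem filter_Ico_natCast_eq_eq_image {m : ℕ} (hm : 0 < m) (c : ZMod m) (a f : ℕ) :
    ∃ n₁ : ℕ, (n₁ : ZMod m) = c ∧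
      (Ico a (a + m * f)).filter (fun n : ℕ => (n : ZMod m) = c) =
        (Finset.range f).image (fun j => n₁ + m * j) := by
  haveI : NeZero m := ⟨hm.ne'⟩
  set i₁ := (c - (a : ZMod m)).val with hi₁
  have hi₁m : i₁ < m := ZMod.val_lt _
  have hcast : ((a + i₁ : ℕ) : ZMod m) = c := by
    push_cast
    rw [hi₁, ZMod.natCast_zmod_val]
    ring
  refine ⟨a + i₁, hcast, ?_⟩
  ext n
  simp only [Finset.mem_filter, Finset.mem_Ico, Finset.mem_image, Finset.mem_range]
  constructor
  · rintro ⟨⟨han, hna⟩, hc⟩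
    have hd : (n - a) % m = i₁ := by
      have h1 : ((n - a : ℕ) : ZMod m) = c - a := by rw [Nat.cast_sub han, hc]
      rw [hi₁, ← h1, ZMod.val_natCast]
    refine ⟨(n - a) / m, Nat.div_lt_of_lt_mul (by omega), ?_⟩
    have e := Nat.div_add_mod (n - a) m
    omega
  · rintro ⟨j, hj, rfl⟩
    refine ⟨⟨by omega, ?_⟩, ?_⟩
    · have h1 : m * j + m ≤ m * f := by rw [← Nat.mul_succ]; exact Nat.mul_le_mul_left m hj
      omega
    · push_cast
      rw [hi₁, ZMod.natCast_zmod_val, ZMod.natCast_self]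
      ring

/-! ### Partial sums of sequences with vanishing period sums -/

/-- If every block of `T` consecutive terms of `g` sums to zero and every block of fewer than `T` terms
has norm at most `M`, then EVERY block of consecutive terms has norm at most `M`. [folklore] -/
theorem norm_sum_Ico_le_of_periodic (g : ℕ → ℂ) {T : ℕ} (hT : 0 < T) {M : ℝ}
    (hzero : ∀ a, ∑ n ∈ Ico a (a + T), g n = 0)
    (hM : ∀ a r, r < T → ‖∑ n ∈ Ico a (a + r), g n‖ ≤ M) (a N : ℕ) :
    ‖∑ n ∈ Ico a (a + N), g n‖ ≤ M := by
  induction N using Nat.strong_induction_on generalizing a with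
  | _ N ih =>
    rcases lt_or_ge N T with h | h
    · exact hM a N h
    · have hsplit := Finset.sum_Ico_consecutive g (Nat.le_add_right a T) (by omega : a + T ≤ a + N)
      rw [← hsplit, hzero, zero_add, show a + N = (a + T) + (N - T) by omega]
      exact ih (N - T) (by omega) (a + T)

/-! ### The primitive case: a class `mod m`, `(m, f) = 1`, `ψ mod f` non-principal -/

/-- The members of a class `mod m` in a window of `mf` consecutive integers have the `f` distinct residues
`mod f` when `(m, f) = 1`; hence `ψ` sums to zero over them for `ψ ≠ ψ₀`. [folklore] -/
theorem sum_filter_natCast_eq_window_eq_zero {f : ℕ} [NeZero f] {ψ : DirichletCharacter ℂ f} (hψ : ψ ≠ 1)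
    {m : ℕ} (hm : 0 < m) (hmf : m.Coprime f) (c : ZMod m) (a : ℕ) :
    ∑ n ∈ (Ico a (a + m * f)).filter (fun n : ℕ => (n : ZMod m) = c), ψ n = 0 := by
  obtain ⟨n₁, -, hset⟩ := filter_Ico_natCast_eq_eq_image hm c a f
  have hinj0 : Set.InjOn (fun j : ℕ => n₁ + m * j) (Finset.range f) := by
    intro j₁ _ j₂ _ h
    exact Nat.eq_of_mul_eq_mul_left hm (by simpa using h)
  rw [hset, Finset.sum_image hinj0]
  have hu : IsUnit (m : ZMod f) := (ZMod.isUnit_iff_coprime m f).2 hmf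
  have hinj : Set.InjOn (fun j : ℕ => ((n₁ + m * j : ℕ) : ZMod f)) (Finset.range f) := by
    intro j₁ hj₁ j₂ hj₂ heq
    simp only [Finset.coe_range, Set.mem_Iio] at hj₁ hj₂
    have h2 : (j₁ : ZMod f) = (j₂ : ZMod f) := by
      simp only [Nat.cast_add, Nat.cast_mul] at heq
      exact hu.mul_left_cancel (add_left_cancel heq)
    rw [ZMod.natCast_eq_natCast_iff'] at h2
    rwa [Nat.mod_eq_of_lt hj₁, Nat.mod_eq_of_lt hj₂] at h2
  have himage : (Finset.range f).image (fun j : ℕ => ((n₁ + m * j : ℕ) : ZMod f)) = Finset.univ := by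
    apply Finset.eq_univ_of_card
    rw [Finset.card_image_of_injOn hinj, Finset.card_range, ZMod.card]
  calc ∑ j ∈ Finset.range f, ψ ((n₁ + m * j : ℕ) : ZMod f)
      = ∑ v ∈ (Finset.range f).image (fun j : ℕ => ((n₁ + m * j : ℕ) : ZMod f)), ψ v :=
        (Finset.sum_image hinj).symm
    _ = ∑ v, ψ v := by rw [himage]
    _ = 0 := MulChar.sum_eq_zero_of_ne_one hψ

/-- **The period bound in the primitive case**: for `ψ mod f`, `ψ ≠ ψ₀`, `(m, f) = 1` and any class
`c mod m`, `|∑_{n ∈ [a, a+N), n ≡ c (m)} ψ(n)| ≤ f`. [cite: MontgomeryVaughan2007, §4.3 eq. (4.23)] -/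
theorem norm_sum_Ico_filter_natCast_eq_le {f : ℕ} [NeZero f] {ψ : DirichletCharacter ℂ f} (hψ : ψ ≠ 1)
    {m : ℕ} (hm : 0 < m) (hmf : m.Coprime f) (c : ZMod m) (a N : ℕ) :
    ‖∑ n ∈ (Ico a (a + N)).filter (fun n : ℕ => (n : ZMod m) = c), ψ n‖ ≤ f := by
  have hf : 0 < f := Nat.pos_of_ne_zero (NeZero.ne f)
  set g : ℕ → ℂ := fun n => if (n : ZMod m) = c then ψ n else 0 with hg
  have hsum : ∀ a N, ∑ n ∈ (Ico a (a + N)).filter (fun n : ℕ => (n : ZMod m) = c), ψ n =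
      ∑ n ∈ Ico a (a + N), g n := fun a N => by rw [hg, Finset.sum_filter]
  rw [hsum]
  refine norm_sum_Ico_le_of_periodic g (Nat.mul_pos hm hf) (fun a => ?_) (fun a r hr => ?_) a N
  · rw [← hsum]
    exact sum_filter_natCast_eq_window_eq_zero hψ hm hmf c a
  · rw [← hsum]
    calc ‖∑ n ∈ (Ico a (a + r)).filter (fun n : ℕ => (n : ZMod m) = c), ψ n‖
        ≤ ∑ n ∈ (Ico a (a + r)).filter (fun n : ℕ => (n : ZMod m) = c), ‖ψ n‖ := norm_sum_le _ _
      _ ≤ ∑ n ∈ (Ico a (a + r)).filter (fun n : ℕ => (n : ZMod m) = c), (1 : ℝ) :=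
          Finset.sum_le_sum fun n _ => ψ.norm_le_one _
      _ = ((Ico a (a + r)).filter (fun n : ℕ => (n : ZMod m) = c)).card := by simp
      _ ≤ ((r / m + 1 : ℕ) : ℝ) := by exact_mod_cast card_Ico_filter_natCast_eq_le c a r
      _ ≤ f := by
          have h1 : r / m < f := Nat.div_lt_of_lt_mul hr
          exact_mod_cast h1

/-! ### Möbius detection of coprimality -/

/-- `[(n, r) = 1] = ∑_{e ∣ r} μ(e) [e ∣ n]` for `r ≠ 0` (complex weights). [folklore] -/
theorem ite_coprime_eq_sum_divisors {r : ℕ} (hr : r ≠ 0) (n : ℕ) :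
    (if n.Coprime r then (1 : ℂ) else 0) = ∑ e ∈ r.divisors, if e ∣ n then (μ e : ℂ) else 0 := by
  -- adapted from Literature/NumberTheory/Sieve/Polymath8aSmoothSiegelWalfisz.lean
  have hset : r.divisors.filter (fun e => e ∣ n) = (Nat.gcd n r).divisors := by
    ext e
    simp only [Finset.mem_filter, Nat.mem_divisors, Nat.dvd_gcd_iff]
    constructor
    · rintro ⟨⟨h1, -⟩, h2⟩
      exact ⟨⟨h2, h1⟩, fun h => hr (Nat.eq_zero_of_gcd_eq_zero_right h)⟩
    · rintro ⟨⟨h2, h1⟩, -⟩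
      exact ⟨⟨h1, hr⟩, h2⟩
  have hμ : ∑ d ∈ (Nat.gcd n r).divisors, (μ d : ℂ) = if Nat.gcd n r = 1 then 1 else 0 := by
    have h := congrArg (fun F : ArithmeticFunction ℂ => F (Nat.gcd n r))
      (ArithmeticFunction.coe_moebius_mul_coe_zeta (R := ℂ))
    simp only [ArithmeticFunction.coe_mul_zeta_apply, ArithmeticFunction.intCoe_apply,
      ArithmeticFunction.one_apply] at h
    exact h
  rw [← Finset.sum_filter, hset, hμ]

/-! ### The bound for a non-principal character along a progression -/

/-- **Period bound along a progression.**  Let `χ` be a Dirichlet character `mod s ≥ 1`, `χ ≠ χ₀`, with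
conductor `f`; let `L ≥ 1` with `(L, s) = 1` and `t mod L`.  Then for every interval `[A, B]`,
`|∑_{A ≤ n ≤ B, n ≡ t (L)} χ(n)| ≤ τ(s) f`. [cite: MontgomeryVaughan2007, §4.3 eq. (4.23); §9.1] -/
theorem norm_sum_Icc_filter_char_le {s : ℕ} [NeZero s] {χ : DirichletCharacter ℂ s} (hχ : χ ≠ 1)
    {L : ℕ} (hL : 0 < L) (hLs : L.Coprime s) (t : ZMod L) (A B : ℕ) :
    ‖∑ n ∈ (Icc A B).filter (fun n : ℕ => (n : ZMod L) = t), χ n‖ ≤ (σ 0 s : ℝ) * χ.conductor := by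
  have hs : 0 < s := Nat.pos_of_ne_zero (NeZero.ne s)
  have hfs : χ.conductor ∣ s := χ.conductor_dvd_level
  set f := χ.conductor with hfdef
  set ψ := χ.primitiveCharacter with hψdef
  have hf0 : f ≠ 0 := χ.conductor_ne_zero
  haveI : NeZero f := ⟨hf0⟩
  have hf : 0 < f := Nat.pos_of_ne_zero hf0
  have hψ1 : ψ ≠ 1 := by
    intro h
    apply hχ
    have h2 := χ.changeLevel_primitiveCharacter
    rw [← h2, ← hψdef, h]
    exact DirichletCharacter.changeLevel_one _
  set r := s / f with hrdef
  have hsr : s = f * r := (Nat.mul_div_cancel' hfs).symm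
  have hr0 : r ≠ 0 := fun h => by rw [h, mul_zero] at hsr; omega
  -- `χ = ψ · 1_{(·, r) = 1}`
  have hχn : ∀ n : ℕ, χ n = if n.Coprime r then ψ n else 0 := fun n => by
    have h1 := BVMoebius.changeLevel_apply_natCast hfs ψ n
    rw [χ.changeLevel_primitiveCharacter] at h1
    rw [h1]
    rfl
  -- the interval as a window
  rcases lt_or_ge B A with hBA | hAB
  · rw [Finset.Icc_eq_empty (by omega), Finset.filter_empty, Finset.sum_empty, norm_zero]
    positivity
  obtain ⟨N, hN⟩ : ∃ N, B + 1 = A + N := ⟨B + 1 - A, by omega⟩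
  have hIcc : Icc A B = Ico A (A + N) := by
    rw [← hN]; rfl
  rw [hIcc]
  -- Möbius
  have hexp : ∑ n ∈ (Ico A (A + N)).filter (fun n : ℕ => (n : ZMod L) = t), χ n =
      ∑ e ∈ r.divisors, (μ e : ℂ) *
        ∑ n ∈ (Ico A (A + N)).filter (fun n : ℕ => (n : ZMod L) = t ∧ e ∣ n), ψ n := by
    calc ∑ n ∈ (Ico A (A + N)).filter (fun n : ℕ => (n : ZMod L) = t), χ n
        = ∑ n ∈ (Ico A (A + N)).filter (fun n : ℕ => (n : ZMod L) = t),
            ∑ e ∈ r.divisors, if e ∣ n then (μ e : ℂ) * ψ n else 0 := by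
          refine Finset.sum_congr rfl fun n _ => ?_
          rw [hχn n]
          have h1 := ite_coprime_eq_sum_divisors hr0 n
          calc (if n.Coprime r then ψ n else 0) = (if n.Coprime r then (1 : ℂ) else 0) * ψ n := by
                split_ifs <;> simp
            _ = (∑ e ∈ r.divisors, if e ∣ n then (μ e : ℂ) else 0) * ψ n := by rw [h1]
            _ = _ := by
                rw [Finset.sum_mul]
                exact Finset.sum_congr rfl fun e _ => by split_ifs <;> simp
      _ = ∑ e ∈ r.divisors, ∑ n ∈ (Ico A (A + N)).filter (fun n : ℕ => (n : ZMod L) = t),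
            if e ∣ n then (μ e : ℂ) * ψ n else 0 := Finset.sum_comm
      _ = _ := by
          refine Finset.sum_congr rfl fun e _ => ?_
          symm
          rw [Finset.mul_sum, ← Finset.filter_filter]
          exact Finset.sum_filter _ _
  rw [hexp]
  -- each `e`-term has norm `≤ f`
  have hterm : ∀ e ∈ r.divisors,
      ‖(μ e : ℂ) * ∑ n ∈ (Ico A (A + N)).filter (fun n : ℕ => (n : ZMod L) = t ∧ e ∣ n), ψ n‖ ≤ f := by
    intro e he
    have he0 : 0 < e := Nat.pos_of_mem_divisors he
    have hes : e ∣ s := (Nat.dvd_of_mem_divisors he).trans ⟨f, by rw [hsr, mul_comm]⟩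
    have hμ1 : ‖(μ e : ℂ)‖ ≤ 1 := by
      rw [Complex.norm_intCast]
      exact_mod_cast ArithmeticFunction.abs_moebius_le_one
    rw [norm_mul]
    refine (mul_le_of_le_one_left (norm_nonneg _) hμ1).trans ?_
    by_cases hef : e.Coprime f
    · -- one class `mod Le`
      have hLe : (L * e).Coprime f :=
        Nat.Coprime.mul_left (Nat.Coprime.coprime_dvd_right hfs hLs) hef
      have heL : e.Coprime L := Nat.Coprime.coprime_dvd_left hes hLs.symm
      haveI : NeZero L := ⟨hL.ne'⟩
      -- a base point of the class
      set n₀ : ℕ := e * (t * ((e : ZMod L))⁻¹).val with hn₀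
      have hn₀L : (n₀ : ZMod L) = t := by
        rw [hn₀]; push_cast
        rw [ZMod.natCast_zmod_val, mul_comm, mul_assoc,
          ZMod.inv_mul_of_unit _ ((ZMod.isUnit_iff_coprime e L).2 heL), mul_one]
      have hn₀e : e ∣ n₀ := ⟨_, hn₀⟩
      have hn₀0 : n₀ ≡ 0 [MOD e] := Nat.modEq_zero_iff_dvd.2 hn₀e
      have hiff : ∀ n : ℕ, ((n : ZMod L) = t ∧ e ∣ n) ↔ (n : ZMod (L * e)) = (n₀ : ZMod (L * e)) := by
        intro n
        rw [ZMod.natCast_eq_natCast_iff, ← Nat.modEq_and_modEq_iff_modEq_mul heL.symm,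
          ← ZMod.natCast_eq_natCast_iff, hn₀L]
        have h2 : n ≡ n₀ [MOD e] ↔ e ∣ n :=
          ⟨fun h => Nat.modEq_zero_iff_dvd.1 (h.trans hn₀0),
            fun h => (Nat.modEq_zero_iff_dvd.2 h).trans hn₀0.symm⟩
        rw [h2]
      rw [Finset.filter_congr (fun n _ => hiff n)]
      have := norm_sum_Ico_filter_natCast_eq_le hψ1 (Nat.mul_pos hL he0) hLe (n₀ : ZMod (L * e)) A N
      exact this
    · -- `(e, f) > 1`: every term vanishes
      have hzero : ∑ n ∈ (Ico A (A + N)).filter (fun n : ℕ => (n : ZMod L) = t ∧ e ∣ n), ψ n = 0 := by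
        refine Finset.sum_eq_zero fun n hn => ?_
        rw [Finset.mem_filter] at hn
        apply MulChar.map_nonunit
        intro hu
        have hnf : n.Coprime f := (ZMod.isUnit_iff_coprime n f).1 hu
        exact hef (Nat.Coprime.coprime_dvd_left hn.2.2 hnf)
      rw [hzero, norm_zero]
      positivity
  calc ‖∑ e ∈ r.divisors, (μ e : ℂ) *
          ∑ n ∈ (Ico A (A + N)).filter (fun n : ℕ => (n : ZMod L) = t ∧ e ∣ n), ψ n‖
      ≤ ∑ e ∈ r.divisors, (f : ℝ) := (norm_sum_le _ _).trans (Finset.sum_le_sum hterm)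
    _ = (r.divisors.card : ℝ) * f := by rw [Finset.sum_const, nsmul_eq_mul]
    _ ≤ (σ 0 s : ℝ) * f := by
        gcongr
        rw [ArithmeticFunction.sigma_zero_apply]
        exact_mod_cast Finset.card_le_card (Nat.divisors_subset_of_dvd hs.ne' ⟨f, by rw [hsr, mul_comm]⟩)

end CharacterAP

end Literature.NumberTheory.Sieve
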